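import Summits.Ventures.PercRepro.RankLevelSetColoopDeviceT22Nine
import Summits.Ventures.PercRepro.RankLevelSetLevelSixT22S1Cf9
import Summits.Ventures.PercRepro.RankLevelSetLevelSixT22S2Cf9
import Summits.Ventures.PercRepro.RankLevelSetLevelSixT22S3Cf9
import Summits.Ventures.PercRepro.RankLevelSetLevelSixT22S4Cf9
import Summits.Ventures.PercRepro.RankLevelSetLevelSixT22S5Cf9
import Summits.Ventures.PercRepro.RankLevelSetLevelSixT22S6Cf9

/-!
# PercRepro — THE CORE CELL `(22, 9)` MODULO ITS COLOOP-FREE CELL (p8 g13, S3)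

`c025_core_six_twentytwo_nine_of_free`: every `e`-free core of rank `22`, corank `9`, satisfies `RLS M 22 6` PROVIDED the
coloop-free cores of that cell do (`h0`). The split is on the number `k` of coloops (the device, `c025_core_six_twentytwo_nine_of`):
`k = 0` is `h0`; `1 ≤ k ≤ 6` are the `k`-times scaled coloop-free cells at rank `22 − k` on the existing cell `sq27di2v`
(`c025_core_six_t22_scaled{k}_cf9`, ratios `0.891 / 0.819 / 0.763 / 0.751 / 0.746 / 0.845`); `k ≥ 7` are the trivial rows.

Axioms: standard.
-/

open scoped Matroid

namespace PercRepro

namespace ThmN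

variable {α : Type}

/-- **THE CORE CELL `(22, 9)` MODULO ITS COLOOP-FREE CELL.** -/
theorem c025_core_six_twentytwo_nine_of_free (M : Matroid α) [M.Finite]
    (hR : M.eRank = (22 : ℕ∞)) (hn : M.E.ncard = 22 + 9)
    (hfree : ∀ e ∈ M.E, ∃ A ⊆ M.E \ {e}, e ∉ M.closure A ∧ e ∉ M.closure ((M.E \ {e}) \ A))
    (h0 : ∀ N : Matroid α, ∀ [N.Finite], (∀ e ∈ N.E, ¬ N.IsColoop e) → N.eRank = (22 : ℕ∞) → N.E.ncard = 22 + 9 →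
      (∀ e ∈ N.E, ∃ A ⊆ N.E \ {e}, e ∉ N.closure A ∧ e ∉ N.closure ((N.E \ {e}) \ A)) → RLS N 22 6) :
    RLS M 22 6 := by
  refine c025_core_six_twentytwo_nine_of M hR hn hfree h0 ?_
  intro k hk1 hk6 N _ hcf hRN hnN hfreeN
  interval_cases k
  · have h := c025_core_six_t22_scaled1_cf9 N 21 le_rfl hcf (by simpa using hRN) (by simpa using hnN) hfreeN
    norm_num at h ⊢
    exact h
  · have h := c025_core_six_t22_scaled2_cf9 N 20 le_rfl hcf (by simpa using hRN) (by simpa using hnN) hfreeN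
    norm_num at h ⊢
    exact h
  · have h := c025_core_six_t22_scaled3_cf9 N 19 le_rfl hcf (by simpa using hRN) (by simpa using hnN) hfreeN
    norm_num at h ⊢
    exact h
  · have h := c025_core_six_t22_scaled4_cf9 N 18 le_rfl hcf (by simpa using hRN) (by simpa using hnN) hfreeN
    norm_num at h ⊢
    exact h
  · have h := c025_core_six_t22_scaled5_cf9 N 17 le_rfl hcf (by simpa using hRN) (by simpa using hnN) hfreeN
    norm_num at h ⊢
    exact h
  · have h := c025_core_six_t22_scaled6_cf9 N 16 le_rfl hcf (by simpa using hRN) (by simpa using hnN) hfreeN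
    norm_num at h ⊢
    exact h

end ThmN

end PercRepro
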